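import Summits.CriticalPhenomena.CardyFormulaZ2.Theorems.CardyComplexConeParafermionToSLESixFamiliesDiamondIdentifyReflection
import Summits.CriticalPhenomena.CardyFormulaZ2.Theorems.CardyComplexConeParafermionToSLESixFamiliesDiamondIdentifyDilation
import Summits.CriticalPhenomena.SAWScalingLimit.Theorems.SAWDevelopingMapObservableToSLEHullApproxCollar
import Literature.Probability.RandomPlanarGeometry.ConformalMapProofs
import Literature.Probability.RandomPlanarGeometry.ArcHullDomains
import Mathlib.Analysis.Complex.CauchyIntegral
import HarnessLib

/-!
# Line `potential-darboux-picard-diamond`, stub S4v (`stub_boundaryIdentification`): the germ of a reflected map at a boundary point, and the chordal uniformizer on the closed half-plane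

Helper file of the stub `stub_boundaryIdentification` of crux `ParafermionToSLESixFamilies` (stmt-CriticalPhenomena-11389).
Step (v) of the identification engine analyses the conformal maps `G` (onto the limit hexagon) and `φ` (from `ℍ` onto
the diamond) near boundary points through the Schwarz reflection principle, on the upper half-plane.

§1 packages the two facts about a map `f` of a half-disc `B(0,r) ∩ {im ≥ 0}` into the closed upper half-plane —
continuous, holomorphic inside, REAL on the diameter and with `im f > 0` inside — that the local analysis consumes:
* `reflectedGerm`: there is a real number `L > 0` such that `(f ζ - f 0)/ζ → L` and `deriv f ζ → L` as `ζ → 0`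
  inside the open half-disc (the reflection `F̂` of `f - f 0` is holomorphic on the disc with `F̂′(0) ≠ 0` by
  `deriv_schwarzReflection_ne_zero_of_im_pos`, p140174; `F̂′(0)` is real as a limit of real difference quotients and
  non-negative as a limit along the imaginary axis);
* `germ_bounds` (registered helper): if moreover `f 0 = 0`, then `c‖ζ‖ ≤ ‖f ζ‖ ≤ C‖ζ‖` and `c ≤ ‖f′ ζ‖ ≤ C` on a
  smaller open half-disc, with `c > 0`.

§2: for a chordal uniformizer `φ : ℍ → D` (`0 ↦ a`, `∞ ↦ b`) the identity `(G′)³ = c·ψ′/ψ` on `D` (`ψ = φ⁻¹`) is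
equivalent to the constancy of the holomorphic function `H(u) = (G′(φ u))³ · u · φ′(u)` on `ℍ`
(`deriv_cube_eq_of_H_const`). §2 provides the Carathéodory extension of `φ` to the closed half-plane in the form
`P = Ψ ∘ cayley` (`uniformizer_extension`, registered helper: `Ψ` continuous and injective on the closed disc, circle
into the frontier, `Ψ(cayley 0) = a`, `Ψ 1 = b`), continuity of `P` and of the extension at infinity
`P₁ = Ψ ∘ (-cayley)` (`= φ ∘ (-1/·)` on `ℍ`, `cayleyFun_neg_inv`) on the closed half-plane, holomorphy of `H`, its
non-vanishing somewhere, and the chain rules relating `H` to `G ∘ φ` and to `φ⁻¹`. (Injectivity of the Cayley transform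
on the closed half-plane and `cayley u ≠ 1` there are reused from `ArcHullDomains` / `…SAWDevelopingMapObservableToSLEHullApproxCollar`.)
-/
noncomputable section

namespace Summit.CriticalPhenomena.CardyFormulaZ2.Cruxes.ParafermionToSLESixFamilies.PotentialDarbouxPicardDiamond

open scoped Topology Real ComplexConjugate
open Filter Set Metric Complex
open UpperHalfPlane (upperHalfPlaneSet isOpen_upperHalfPlaneSet)
open Literature.Probability.RandomPlanarGeometry
open Summit.CriticalPhenomena.SAWScalingLimit.Theorems.ObservableToSLE.FloorRatio (cayleyFun_ne_one)

/-! ## §1 The germ of a reflected map -/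

/-- The open upper half-plane as a neighbourhood filter base: `B(0,r) ∩ {im > 0}` belongs to `𝓝[{im > 0}] 0`. -/
theorem ball_inter_mem_nhdsWithin_pos {r : ℝ} (hr : 0 < r) :
    ball (0:ℂ) r ∩ {z : ℂ | 0 < z.im} ∈ 𝓝[{z : ℂ | 0 < z.im}] (0:ℂ) :=
  inter_mem (mem_nhdsWithin_of_mem_nhds (ball_mem_nhds 0 hr)) self_mem_nhdsWithin

/-- **The germ of a reflected map at a boundary point.** Let `f` be continuous on `B(0,r) ∩ {im ≥ 0}`, holomorphic
on `B(0,r) ∩ {im > 0}`, real on the diameter and with `im f > 0` on the open half-disc. Then for some real `L > 0`,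
`(f ζ - f 0)/ζ → L` and `deriv f ζ → L` as `ζ → 0` within the open upper half-plane. -/
theorem reflectedGerm (f : ℂ → ℂ) {r : ℝ} (hr : 0 < r)
    (hc : ContinuousOn f (ball (0:ℂ) r ∩ {z : ℂ | 0 ≤ z.im}))
    (hd : DifferentiableOn ℂ f (ball (0:ℂ) r ∩ {z : ℂ | 0 < z.im}))
    (hreal : ∀ z ∈ ball (0:ℂ) r, z.im = 0 → (f z).im = 0)
    (hpos : ∀ z ∈ ball (0:ℂ) r, 0 < z.im → 0 < (f z).im) :
    ∃ L : ℝ, 0 < L ∧ Tendsto (fun ζ => (f ζ - f 0) / ζ) (𝓝[{z : ℂ | 0 < z.im}] 0) (𝓝 (L : ℂ)) ∧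
      Tendsto (deriv f) (𝓝[{z : ℂ | 0 < z.im}] 0) (𝓝 (L : ℂ)) := by
  set g : ℂ → ℂ := fun z => f z - f 0 with hg
  have hf0 : (f 0).im = 0 := hreal 0 (mem_ball_self hr) rfl
  have hgc : ContinuousOn g (ball 0 r ∩ {z : ℂ | 0 ≤ z.im}) := hc.sub continuousOn_const
  have hgd : DifferentiableOn ℂ g (ball 0 r ∩ {z : ℂ | 0 < z.im}) := hd.sub_const _
  have hgreal : ∀ z ∈ ball (0:ℂ) r, z.im = 0 → conj (g z) = g z := fun z hz hzim =>
    conj_eq_iff_im.2 (by simp [hg, hreal z hz hzim, hf0])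
  have hg0 : g 0 = 0 := sub_self _
  have hgpos : ∀ z ∈ ball (0:ℂ) r, 0 < z.im → 0 < (g z).im := fun z hz hzim => by
    simpa [hg, hf0] using hpos z hz hzim
  obtain ⟨hGd, hG0⟩ := deriv_schwarzReflection_ne_zero_of_im_pos g r hr hgc hgd hgreal hg0 hgpos
  set G := schwarzReflection g with hG
  have hGg : ∀ z : ℂ, 0 ≤ z.im → G z = g z := fun z hz => schwarzReflection_of_nonneg hz
  have hG00 : G 0 = 0 := by rw [hGg 0 (by simp), hg0]
  set L : ℂ := deriv G 0 with hL
  have hderiv : HasDerivAt G L 0 := (hGd.differentiableAt (ball_mem_nhds 0 hr)).hasDerivAt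
  have hslope : Tendsto (fun z => G z / z) (𝓝[≠] 0) (𝓝 L) := by
    refine (hasDerivAt_iff_tendsto_slope.1 hderiv).congr' ?_
    filter_upwards [self_mem_nhdsWithin] with z _
    rw [slope_def_field, hG00, sub_zero, sub_zero]
  -- `L` is real: the difference quotients along the real axis are real
  have hLim : L.im = 0 := by
    have ht : Tendsto (fun t : ℝ => (t : ℂ)) (𝓝[≠] 0) (𝓝[≠] 0) :=
      tendsto_nhdsWithin_iff.2 ⟨by simpa using (continuous_ofReal.tendsto 0).mono_left nhdsWithin_le_nhds,
        eventually_nhdsWithin_of_forall fun t (ht : t ≠ 0) => by simpa using ht⟩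
    have h1 : Tendsto (fun t : ℝ => (G t / t).im) (𝓝[≠] 0) (𝓝 L.im) :=
      (continuous_im.tendsto L).comp (hslope.comp ht)
    have h2 : ∀ᶠ t : ℝ in 𝓝[≠] 0, (G t / t).im = 0 := by
      have hb : ∀ᶠ t : ℝ in 𝓝 0, (t : ℂ) ∈ ball (0:ℂ) r :=
        (continuous_ofReal.tendsto' 0 0 (by simp)).eventually (ball_mem_nhds 0 hr)
      filter_upwards [mem_nhdsWithin_of_mem_nhds hb] with t htb
      have hGt : G t = g t := hGg t (by simp)
      have hgt : (g t).im = 0 := by rw [← conj_eq_iff_im]; exact hgreal _ htb (by simp)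
      rw [hGt, div_ofReal_im, hgt, zero_div]
    have h3 : Tendsto (fun t : ℝ => (G t / t).im) (𝓝[≠] 0) (𝓝 0) :=
      tendsto_const_nhds.congr' (by filter_upwards [h2] with t ht; exact ht.symm)
    exact tendsto_nhds_unique h1 h3
  -- `L` has non-negative real part: the quotients along the imaginary axis have positive real part
  have hLre : 0 ≤ L.re := by
    have ht : Tendsto (fun t : ℝ => (t : ℂ) * I) (𝓝[>] 0) (𝓝[≠] 0) := by
      refine tendsto_nhdsWithin_iff.2 ⟨?_, ?_⟩
      · have : Tendsto (fun t : ℝ => (t : ℂ) * I) (𝓝 0) (𝓝 ((0:ℝ) * I)) :=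
          ((continuous_ofReal.mul continuous_const).tendsto 0)
        simpa using this.mono_left nhdsWithin_le_nhds
      · filter_upwards [self_mem_nhdsWithin] with t (ht : 0 < t)
        simp [ht.ne']
    have h1 : Tendsto (fun t : ℝ => (G (t * I) / (t * I)).re) (𝓝[>] 0) (𝓝 L.re) :=
      (continuous_re.tendsto L).comp (hslope.comp ht)
    have h2 : ∀ᶠ t : ℝ in 𝓝[>] 0, 0 ≤ (G (t * I) / (t * I)).re := by
      have hb : ∀ᶠ t : ℝ in 𝓝 0, (t : ℂ) * I ∈ ball (0:ℂ) r := by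
        have : Tendsto (fun t : ℝ => (t : ℂ) * I) (𝓝 0) (𝓝 ((0:ℝ) * I)) :=
          ((continuous_ofReal.mul continuous_const).tendsto 0)
        simp only [ofReal_zero, zero_mul] at this
        exact this.eventually (ball_mem_nhds 0 hr)
      filter_upwards [mem_nhdsWithin_of_mem_nhds hb, self_mem_nhdsWithin] with t htb (ht : 0 < t)
      have him : 0 < ((t : ℂ) * I).im := by simp [ht]
      have hGt : G (t * I) = g (t * I) := hGg _ him.le
      have hq : G (t * I) / (t * I) = g (t * I) * (-I) / t := by
        rw [hGt]; field_simp; ring_nf; simp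
      rw [hq, div_ofReal_re]
      have : (g (t * I) * -I).re = (g (t * I)).im := by simp
      rw [this]
      exact div_nonneg (hgpos _ htb him).le ht.le
    exact ge_of_tendsto h1 h2
  have hLpos : 0 < L.re := by
    rcases hLre.lt_or_eq with h | h
    · exact h
    · exfalso; apply hG0
      exact Complex.ext (by simpa using h.symm) (by simpa using hLim)
  have hLeq : L = ((L.re : ℝ) : ℂ) := Complex.ext (by simp) (by simp [hLim])
  refine ⟨L.re, hLpos, ?_, ?_⟩
  · rw [← hLeq]
    refine (hslope.mono_left (nhdsWithin_mono _ fun z (hz : 0 < z.im) => ?_)).congr' ?_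
    · rintro (rfl : z = 0); simp at hz
    · filter_upwards [self_mem_nhdsWithin] with z (hz : 0 < z.im)
      rw [hGg z hz.le]
  · rw [← hLeq]
    have hcont : ContinuousAt (deriv G) 0 :=
      ((hGd.analyticOnNhd isOpen_ball).deriv.continuousOn.continuousAt (ball_mem_nhds 0 hr))
    refine (hcont.tendsto.mono_left nhdsWithin_le_nhds).congr' ?_
    filter_upwards [ball_inter_mem_nhdsWithin_pos hr] with z hz
    have hev : G =ᶠ[𝓝 z] g := by
      filter_upwards [(isOpen_lt continuous_const continuous_im).mem_nhds hz.2] with y hy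
      exact hGg y (le_of_lt hy)
    rw [hev.deriv_eq]
    simp [hg]

/-- **Two-sided bounds for a reflected map vanishing at the boundary point** (registered helper). Let `f` be continuous
on `B(0,r) ∩ {im ≥ 0}`, holomorphic on `B(0,r) ∩ {im > 0}`, real on the diameter, with `f 0 = 0` and `im f > 0` on the
open half-disc. Then on a smaller open half-disc `c‖ζ‖ ≤ ‖f ζ‖ ≤ C‖ζ‖` and `c ≤ ‖f′ ζ‖ ≤ C` with `c > 0`. -/
theorem germ_bounds : ∀ (f : ℂ → ℂ) (r : ℝ), 0 < r → ContinuousOn f (Metric.ball (0:ℂ) r ∩ {z : ℂ | 0 ≤ z.im}) → DifferentiableOn ℂ f (Metric.ball (0:ℂ) r ∩ {z : ℂ | 0 < z.im}) → (∀ z ∈ Metric.ball (0:ℂ) r, z.im = 0 → (f z).im = 0) → f 0 = 0 → (∀ z ∈ Metric.ball (0:ℂ) r, 0 < z.im → 0 < (f z).im) → ∃ c C r' : ℝ, 0 < c ∧ 0 < C ∧ 0 < r' ∧ r' ≤ r ∧ ∀ ζ ∈ Metric.ball (0:ℂ) r', 0 < ζ.im → c * ‖ζ‖ ≤ ‖f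 ζ‖ ∧ ‖f ζ‖ ≤ C * ‖ζ‖ ∧ c ≤ ‖deriv f ζ‖ ∧ ‖deriv f ζ‖ ≤ C := by
  intro f r hr hc hd hreal h0 hpos
  obtain ⟨L, hL, h1, h2⟩ := reflectedGerm f hr hc hd hreal hpos
  have hL2 : 0 < L / 2 := by linarith
  have e1 : ∀ᶠ ζ in 𝓝[{z : ℂ | 0 < z.im}] 0, dist ((f ζ - f 0) / ζ) L < L / 2 := h1 (ball_mem_nhds _ hL2)
  have e2 : ∀ᶠ ζ in 𝓝[{z : ℂ | 0 < z.im}] 0, dist (deriv f ζ) L < L / 2 := h2 (ball_mem_nhds _ hL2)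
  obtain ⟨ρ, hρ, hball⟩ := Metric.mem_nhdsWithin_iff.1 (e1.and e2)
  refine ⟨L / 2, 2 * L, min ρ r, hL2, by linarith, lt_min hρ hr, min_le_right _ _, fun ζ hζ hζim => ?_⟩
  have hζρ : ζ ∈ ball (0:ℂ) ρ := ball_subset_ball (min_le_left _ _) hζ
  obtain ⟨d1, d2⟩ := hball ⟨hζρ, hζim⟩
  simp only [h0, sub_zero, dist_eq_norm] at d1 d2
  have hζ0 : ζ ≠ 0 := by rintro rfl; simp at hζim
  have hζn : 0 < ‖ζ‖ := norm_pos_iff.2 hζ0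
  have hLn : ‖(L : ℂ)‖ = L := by rw [norm_real, Real.norm_eq_abs, abs_of_pos hL]
  -- quotient bounds
  have hq1 : L / 2 ≤ ‖f ζ / ζ‖ := by
    have := norm_sub_norm_le (L : ℂ) (f ζ / ζ)
    rw [norm_sub_rev] at d1
    linarith
  have hq2 : ‖f ζ / ζ‖ ≤ 2 * L := by
    have := norm_le_norm_add_norm_sub' (f ζ / ζ) (L : ℂ)
    have h' : ‖f ζ / ζ - L‖ < L / 2 := d1
    linarith
  rw [norm_div] at hq1 hq2
  refine ⟨?_, ?_, ?_, ?_⟩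
  · rwa [le_div_iff₀ hζn] at hq1
  · rwa [div_le_iff₀ hζn] at hq2
  · have := norm_sub_norm_le (L : ℂ) (deriv f ζ)
    rw [norm_sub_rev] at d2
    linarith
  · have := norm_le_norm_add_norm_sub' (deriv f ζ) (L : ℂ)
    have h' : ‖deriv f ζ - L‖ < L / 2 := d2
    linarith

/-! ## §2 The chordal uniformizer on the closed half-plane

### The Cayley transform on the closed half-plane -/

/-- The Cayley transform is continuous on the closed upper half-plane. -/
theorem continuousOn_cayleyFun_closedHalfPlane : ContinuousOn cayleyFun {u : ℂ | 0 ≤ u.im} :=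
  continuousOn_cayleyFun.mono fun _ hu => add_I_ne_zero hu

/-- The Cayley transform maps the closed upper half-plane into the closed unit disc. -/
theorem cayleyFun_mem_closedBall {u : ℂ} (hu : 0 ≤ u.im) : cayleyFun u ∈ closedBall (0:ℂ) 1 :=
  mem_closedBall_zero_iff.2 (norm_cayleyFun_le_one hu)

/-- The Cayley transform maps the real axis into the unit circle. -/
theorem cayleyFun_mem_sphere {u : ℂ} (hu : u.im = 0) : cayleyFun u ∈ sphere (0:ℂ) 1 := by
  have : u = ((u.re : ℝ) : ℂ) := Complex.ext (by simp) (by simp [hu])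
  rw [this, mem_sphere_zero_iff_norm]
  exact norm_cayleyFun_ofReal _

/-- **The Cayley transform and the inversion `u ↦ -1/u`**: `cayley (-τ⁻¹) = -cayley τ` for `τ ≠ 0` in the closed
upper half-plane. -/
theorem cayleyFun_neg_inv {τ : ℂ} (hτ : 0 ≤ τ.im) (hτ0 : τ ≠ 0) : cayleyFun (-τ⁻¹) = -cayleyFun τ := by
  have h1 : τ + I ≠ 0 := add_I_ne_zero hτ
  have h4 : -1 + I * τ ≠ 0 := by
    intro h
    have : τ = -I := by
      have h' : I * τ = 1 := by linear_combination h
      calc τ = -I * (I * τ) := by rw [← mul_assoc]; simp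
        _ = -I := by rw [h', mul_one]
    rw [this] at hτ; norm_num at hτ
  rw [cayleyFun_apply, cayleyFun_apply]
  have e1 : -τ⁻¹ - I = (-1 - I * τ) / τ := by field_simp
  have e2 : -τ⁻¹ + I = (-1 + I * τ) / τ := by field_simp
  rw [e1, e2, div_div_div_cancel_right₀ hτ0, div_eq_iff h4, neg_div', div_mul_eq_mul_div, eq_div_iff h1]
  ring_nf
  simp only [I_sq]
  ring

/-- `-cayley τ` stays in the closed unit disc. -/
theorem neg_cayleyFun_mem_closedBall {u : ℂ} (hu : 0 ≤ u.im) : -cayleyFun u ∈ closedBall (0:ℂ) 1 := by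
  rw [mem_closedBall_zero_iff, norm_neg]; exact norm_cayleyFun_le_one hu

/-! ## The Carathéodory extension of a chordal uniformizer -/

/-- **The chordal uniformizer on the closed half-plane** (registered helper). For a chordal uniformizer `φ` of a
Dobrushin domain there is a map `Ψ`, continuous and injective on the closed unit disc, mapping it into the closed
carrier and the unit circle into the frontier, with `φ = Ψ ∘ cayley` on `ℍ`, `Ψ (cayley 0) = D.pt 0` and `Ψ 1 = D.pt 1`
(Carathéodory's theorem `JordanDomain.exists_continuousOn_extension_holds`, Pommerenke Thm. 2.6, a theorem of the tree,
and the boundary normalisation of `φ`). -/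
theorem uniformizer_extension : ∀ (D : DobrushinDomain) (φ : ConformalEquiv upperHalfPlaneSet D.carrier), D.IsChordalUniformizing φ → ∃ Ψ : ℂ → ℂ, ContinuousOn Ψ (Metric.closedBall 0 1) ∧ Set.InjOn Ψ (Metric.closedBall 0 1) ∧ Set.MapsTo Ψ (Metric.closedBall 0 1) (closure D.carrier) ∧ Set.MapsTo Ψ (Metric.sphere 0 1) (frontier D.carrier) ∧ (∀ u ∈ upperHalfPlaneSet, φ u = Ψ (cayleyFun u)) ∧ Ψ (cayleyFun 0) = D.pt 0 ∧ Ψ 1 = D.pt 1 := by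
  intro D φ hφ
  obtain ⟨Ψ, hΨc, hΨeq, hbij, hsph⟩ := JordanDomain.exists_continuousOn_extension_holds D.toJordanDomain (cayley.symm.trans φ)
  refine ⟨Ψ, hΨc, hbij.injOn, hbij.mapsTo, hsph.mapsTo, fun u hu => JordanDomain.eqOn_comp_cayleyFun φ hΨeq hu, ?_, ?_⟩
  · have := JordanDomain.extension_cayleyFun_eq φ hΨc hΨeq (x := 0) (p := D.pt 0) (by exact_mod_cast hφ.1)
    simpa using this
  · exact JordanDomain.extension_one_eq φ hΨc hΨeq hφ.2

/-- The extension `P = Ψ ∘ cayley` is continuous on the closed half-plane. -/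
theorem continuousOn_extP {Ψ : ℂ → ℂ} (hΨc : ContinuousOn Ψ (closedBall 0 1)) :
    ContinuousOn (fun u => Ψ (cayleyFun u)) {u : ℂ | 0 ≤ u.im} :=
  hΨc.comp continuousOn_cayleyFun_closedHalfPlane fun _ hu => cayleyFun_mem_closedBall hu

/-- The extension at infinity `P₁ = Ψ ∘ (-cayley)` is continuous on the closed half-plane. -/
theorem continuousOn_extP₁ {Ψ : ℂ → ℂ} (hΨc : ContinuousOn Ψ (closedBall 0 1)) :
    ContinuousOn (fun u => Ψ (-cayleyFun u)) {u : ℂ | 0 ≤ u.im} :=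
  hΨc.comp continuousOn_cayleyFun_closedHalfPlane.neg fun _ hu => neg_cayleyFun_mem_closedBall hu

/-- `P` is injective on the closed half-plane. -/
theorem injOn_extP {Ψ : ℂ → ℂ} (hΨi : InjOn Ψ (closedBall 0 1)) :
    InjOn (fun u => Ψ (cayleyFun u)) {u : ℂ | 0 ≤ u.im} := fun _ hu _ hv h =>
  cayleyFun_injOn hu hv (hΨi (cayleyFun_mem_closedBall hu) (cayleyFun_mem_closedBall hv) h)

/-- No real point is sent to `b = Ψ 1` by `P`. -/
theorem extP_ne_pt_one {Ψ : ℂ → ℂ} (hΨi : InjOn Ψ (closedBall 0 1)) {u : ℂ} (hu : 0 ≤ u.im) :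
    Ψ (cayleyFun u) ≠ Ψ 1 := fun h =>
  cayleyFun_ne_one hu (hΨi (cayleyFun_mem_closedBall hu) (by simp) h)

/-! ## The function `H` -/

/-- The derivative of a conformal equivalence of `ℍ` does not vanish, and `(φ⁻¹)′(φ u) = (φ′ u)⁻¹`. -/
theorem deriv_symm_eq_inv {V : Set ℂ} (φ : ConformalEquiv upperHalfPlaneSet V) {u : ℂ} (hu : u ∈ upperHalfPlaneSet) :
    deriv φ u ≠ 0 ∧ deriv φ.symm (φ u) = (deriv φ u)⁻¹ := by
  have h1 := φ.deriv_symm_mul_deriv isOpen_upperHalfPlaneSet hu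
  have h2 : deriv φ u ≠ 0 := ConformalEquiv.deriv_ne_zero_holds φ isOpen_upperHalfPlaneSet hu
  exact ⟨h2, eq_inv_of_mul_eq_one_left h1⟩

/-- **Chain rule for `G ∘ φ`.** -/
theorem deriv_comp_uniformizer {D : DobrushinDomain} (φ : ConformalEquiv upperHalfPlaneSet D.carrier) {G : ℂ → ℂ}
    (hG : DifferentiableOn ℂ G D.carrier) {u : ℂ} (hu : u ∈ upperHalfPlaneSet) :
    deriv (fun v => G (φ v)) u = deriv G (φ u) * deriv φ u := by
  have h1 : DifferentiableAt ℂ G (φ u) := hG.differentiableAt (D.isOpen.mem_nhds (φ.mapsTo hu))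
  have h2 : DifferentiableAt ℂ φ u := (φ.differentiableOn u hu).differentiableAt (isOpen_upperHalfPlaneSet.mem_nhds hu)
  exact deriv_comp u h1 h2

/-- **`H(u) = (G′(φ u))³ · u · φ′(u)` is holomorphic on `ℍ`.** -/
theorem differentiableOn_H {D : DobrushinDomain} (φ : ConformalEquiv upperHalfPlaneSet D.carrier) {G : ℂ → ℂ}
    (hG : DifferentiableOn ℂ G D.carrier) :
    DifferentiableOn ℂ (fun u => deriv G (φ u) ^ 3 * u * deriv φ u) upperHalfPlaneSet := by
  have h1 : DifferentiableOn ℂ (deriv G) D.carrier := (hG.analyticOnNhd D.isOpen).deriv.differentiableOn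
  have h2 : DifferentiableOn ℂ (fun u => deriv G (φ u)) upperHalfPlaneSet := h1.comp φ.differentiableOn φ.mapsTo
  have h3 : DifferentiableOn ℂ (deriv φ) upperHalfPlaneSet :=
    (φ.differentiableOn.analyticOnNhd isOpen_upperHalfPlaneSet).deriv.differentiableOn
  exact ((h2.pow 3).mul differentiableOn_id).mul h3

/-- **From the constancy of `H` to the identification for `φ`.** If `H ≡ cst` on `ℍ`, then
`(G′ w)³ = cst · (φ⁻¹)′(w) / φ⁻¹(w)` for every `w ∈ D`. -/
theorem deriv_cube_eq_of_H_const {D : DobrushinDomain} (φ : ConformalEquiv upperHalfPlaneSet D.carrier) {G : ℂ → ℂ}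
    {cst : ℂ} (hH : ∀ u ∈ upperHalfPlaneSet, deriv G (φ u) ^ 3 * u * deriv φ u = cst) :
    ∀ w ∈ D.carrier, deriv G w ^ 3 = cst * (deriv (fun x : ℂ => φ.symm x) w / φ.symm w) := by
  intro w hw
  set u := φ.symm w with hu
  have huH : u ∈ upperHalfPlaneSet := φ.symm_mapsTo hw
  have hφu : φ u = w := φ.apply_symm_apply hw
  obtain ⟨hd0, hdsymm⟩ := deriv_symm_eq_inv φ huH
  have hu0 : u ≠ 0 := by rintro h; have : (0:ℝ) < u.im := huH; rw [h] at this; simp at this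
  have hH' := hH u huH
  rw [hφu] at hH' hdsymm
  rw [show (fun x : ℂ => φ.symm x) = φ.symm from rfl, hdsymm, ← hH']
  field_simp

/-- **`H` does not vanish identically**: an injective holomorphic `G` on the carrier has a point with `G′ ≠ 0`, hence
`H ≠ 0` at its `φ`-preimage. -/
theorem exists_H_ne_zero {D : DobrushinDomain} (φ : ConformalEquiv upperHalfPlaneSet D.carrier) {G : ℂ → ℂ}
    (hG : DifferentiableOn ℂ G D.carrier) (hGi : InjOn G D.carrier) :
    ∃ u ∈ upperHalfPlaneSet, deriv G (φ u) ^ 3 * u * deriv φ u ≠ 0 := by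
  -- a point with non-vanishing derivative
  have hex : ∃ w ∈ D.carrier, deriv G w ≠ 0 := by
    by_contra hall
    push Not at hall
    obtain ⟨w₀, hw₀⟩ := D.nonempty
    obtain ⟨ε, hε, hball⟩ := Metric.isOpen_iff.1 D.isOpen w₀ hw₀
    have hw₁ : w₀ + (ε / 2 : ℝ) ∈ D.carrier := hball (by
      rw [mem_ball, dist_eq_norm, add_sub_cancel_left, norm_real, Real.norm_eq_abs, abs_of_pos (by linarith)]
      linarith)
    have hconst := IsOpen.is_const_of_deriv_eq_zero D.isOpen D.isConnected.isPreconnected hG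
      (fun z hz => by simp [hall z hz]) hw₀ hw₁
    have := hGi hw₀ hw₁ hconst
    have h2 : ((ε / 2 : ℝ) : ℂ) = 0 := by linear_combination -this
    have h3 : (ε / 2 : ℝ) = 0 := by exact_mod_cast h2
    linarith
  obtain ⟨w, hw, hGw⟩ := hex
  refine ⟨φ.symm w, φ.symm_mapsTo hw, ?_⟩
  have huH : φ.symm w ∈ upperHalfPlaneSet := φ.symm_mapsTo hw
  have hu0 : φ.symm w ≠ 0 := by rintro h; have : (0:ℝ) < (φ.symm w).im := huH; rw [h] at this; simp at this
  rw [φ.apply_symm_apply hw]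
  exact mul_ne_zero (mul_ne_zero (pow_ne_zero _ hGw) hu0) (deriv_symm_eq_inv φ huH).1

/-- **`H` along the inversion**: with `φ₁ τ = φ (-τ⁻¹)`, for `τ ∈ ℍ`,
`H(-τ⁻¹) = -(G′(φ₁ τ))³ · τ · φ₁′(τ)`, and `‖H(-τ⁻¹)‖ = ‖G′(φ₁ τ)‖³ ‖τ‖ ‖φ₁′ τ‖`. -/
theorem H_inv_eq {D : DobrushinDomain} (φ : ConformalEquiv upperHalfPlaneSet D.carrier) {G : ℂ → ℂ} {τ : ℂ}
    (hτ : τ ∈ upperHalfPlaneSet) :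
    -τ⁻¹ ∈ upperHalfPlaneSet ∧
    deriv (fun σ => φ (-σ⁻¹)) τ = deriv φ (-τ⁻¹) * (τ ^ 2)⁻¹ ∧
    ‖deriv G (φ (-τ⁻¹)) ^ 3 * (-τ⁻¹) * deriv φ (-τ⁻¹)‖ =
      ‖deriv G (φ (-τ⁻¹))‖ ^ 3 * ‖τ‖ * ‖deriv (fun σ => φ (-σ⁻¹)) τ‖ := by
  have hτim : 0 < τ.im := hτ
  have hτ0 : τ ≠ 0 := by rintro rfl; simp at hτim
  have hmem : -τ⁻¹ ∈ upperHalfPlaneSet := by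
    show 0 < (-τ⁻¹).im
    rw [neg_im, inv_im, neg_div, neg_neg]
    exact div_pos hτim (normSq_pos.2 hτ0)
  have hg : HasDerivAt (fun σ : ℂ => -σ⁻¹) ((τ ^ 2)⁻¹) τ := by
    show HasDerivAt (-(fun y : ℂ => y⁻¹)) ((τ ^ 2)⁻¹) τ
    simpa using (hasDerivAt_inv hτ0).neg
  have hφd : DifferentiableAt ℂ φ (-τ⁻¹) :=
    (φ.differentiableOn _ hmem).differentiableAt (isOpen_upperHalfPlaneSet.mem_nhds hmem)
  have hchain : deriv (fun σ => φ (-σ⁻¹)) τ = deriv φ (-τ⁻¹) * (τ ^ 2)⁻¹ := by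
    have := hφd.hasDerivAt.comp τ hg
    exact this.deriv
  refine ⟨hmem, hchain, ?_⟩
  rw [hchain, norm_mul, norm_mul, norm_mul, norm_pow, norm_neg, norm_inv, norm_inv, norm_pow]
  have hn : ‖τ‖ ≠ 0 := norm_ne_zero_iff.2 hτ0
  field_simp

end Summit.CriticalPhenomena.CardyFormulaZ2.Cruxes.ParafermionToSLESixFamilies.PotentialDarbouxPicardDiamond

end
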